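import Summits.MatrixMultiplication.MatrixMultiplication.Theorems.ObstructionDescentSquareRegimeSaturation
import Summits.MatrixMultiplication.MatrixMultiplication.Theorems.ObstructionDescentCornerOddLevel
import Summits.MatrixMultiplication.MatrixMultiplication.Theorems.ObstructionDescentFormatTwoPassLevels

set_option linter.dupNamespace false

/-!
# Obstruction descent, part T — the saturation window of the invariant tower (kernel map for NODE-g15)

`route-MatrixMultiplication-ObstructionDescent`, aside `InvariantSaturation` (stmt 32282); decomp-mm lens-3, NODE-g15.

The aside asks the PASS-OR-EMPTY dichotomy `k ∈ passLevels m N ∪ emptyLevels m N` for block format `N = n²`, in the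
cells `n^τ ≤ m` (`2 < τ < 4`) and levels `k N > m`.  This file assembles the kernel map of where the dichotomy is
DECIDED, from parts K–S and the tree:

* HOLDS in the secant regime `k N ≤ m` (tree, `mem_passLevels_of_degree_le`) and in the square regime `N² ≤ m`
  (part S) — `dichotomy_of_degree_le_or_sq_le`; and in the whole column `N = 2` (parts N–Q) — `dichotomy_two`;
* is REDUCED TO EMPTINESS on the odd diagonal cells: for odd `k`, `2 ≤ N ≤ m`, `(k−1)(m−1) < k(N−1)`, level `k` does
  not pass (part P), so the dichotomy there holds iff `k ∈ emptyLevels N N` (`dichotomy_iff_empty_of_odd_diagonal`;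
  level `3`: cells `2m + 1 < 3N`, `dichotomy_iff_empty_level_three`).  In particular a non-empty level `3` at block
  format `N` (`g((3^N)³) > 0`, e.g. Strassen's invariant at `N = 3`) makes the dichotomy FAIL in every cell
  `N ≤ m < (3N−1)/2` (`not_dichotomy_level_three`): the window of the item cannot be opened down to the diagonal `τ = 2`.
* Point levels of the unit tensor in column `2`: `pointLevels 2 ⟨m⟩ = 2ℕ` (`mem_pointLevels_two_unitTensor_iff`).

[cite: BurgisserIkenmeyer2011, §3.1–3.2, Lemma 3.2, §6.2], [cite: BurgisserIkenmeyer2017, §5 (5.2), Thm 5.3],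
[cite: LandsbergGCT2017, §8.3.4].
-/

noncomputable section

open scoped BigOperators
open Finset

namespace Summit.MatrixMultiplication.MatrixMultiplication.Theorems.ObstructionCalculus

open Literature.Computability.AlgebraicComplexity (unitTensor tensorRank)

section SaturationWindow

/-- **The two decided regimes:** the dichotomy holds for every level of degree `kN ≤ m` and, when `N² ≤ m` (`N ≤ m`),
for every level. [this node] -/
theorem dichotomy_of_degree_le_or_sq_le {m N k : ℕ} (hNm : N ≤ m) (h : k * N ≤ m ∨ N * N ≤ m) :
    k ∈ passLevels m N ∪ emptyLevels m N := by
  rcases h with hk | hsq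
  · by_cases he : k ∈ emptyLevels m N
    · exact Or.inr he
    · exact Or.inl (mem_passLevels_of_degree_le hk he)
  · exact mem_passLevels_union_emptyLevels_of_sq_le hNm hsq k

/-- **Column 2 is decided:** for `m ≥ 2` every level of block format `2` passes (even) or is empty (odd). [this node] -/
theorem dichotomy_two {m : ℕ} (hm : 2 ≤ m) (k : ℕ) : k ∈ passLevels m 2 ∪ emptyLevels m 2 :=
  mem_passLevels_two_or_mem_emptyLevels_two hm k

/-- **Odd diagonal cells are reduced to emptiness:** for odd `k`, `2 ≤ N ≤ m` and `(k−1)(m−1) < k(N−1)` the level `k`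
does not pass, so the dichotomy at `(m, N, k)` holds iff level `k` is empty at block format `N` itself. [this node] -/
theorem dichotomy_iff_empty_of_odd_diagonal {m N k : ℕ} (hk : Odd k) (hN : 2 ≤ N) (hNm : N ≤ m)
    (hm : (k - 1) * (m - 1) < k * (N - 1)) :
    (k ∈ passLevels m N ∪ emptyLevels m N) ↔ k ∈ emptyLevels N N := by
  have hnp : k ∉ passLevels m N := by
    intro h
    apply h
    intro F hF A B C _ _ _
    exact evalT_eq_zero_of_odd_level_corner hk hN hNm hF hm
      ((Literature.Computability.AlgebraicComplexity.tensorRestrictsTo_actTensor A B C _).tensorRank_le.trans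
        (tensorRank_unitTensor_le' m))
  rw [Set.mem_union, mem_emptyLevels_iff_self hNm]
  exact ⟨fun h => h.resolve_left hnp, Or.inr⟩

/-- Level `3`: in the cells `2 ≤ N ≤ m`, `2m + 1 < 3N` the dichotomy holds iff `3 ∈ emptyLevels N N`. [this node] -/
theorem dichotomy_iff_empty_level_three {m N : ℕ} (hN : 2 ≤ N) (hNm : N ≤ m) (hm : 2 * m + 1 < 3 * N) :
    (3 ∈ passLevels m N ∪ emptyLevels m N) ↔ 3 ∈ emptyLevels N N :=
  dichotomy_iff_empty_of_odd_diagonal (by decide) hN hNm (by omega)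

/-- **The window cannot reach the diagonal:** if level `3` is non-empty at block format `N ≥ 2` (`g((3^N)³) > 0`), the
pass-or-empty dichotomy FAILS in every cell `N ≤ m`, `2m + 1 < 3N`. [this node] -/
theorem not_dichotomy_level_three {m N : ℕ} (hN : 2 ≤ N) (hNm : N ≤ m) (hm : 2 * m + 1 < 3 * N)
    (h3 : 3 ∉ emptyLevels N N) : 3 ∉ passLevels m N ∪ emptyLevels m N := fun h =>
  h3 ((dichotomy_iff_empty_level_three hN hNm hm).mp h)

/-- The same for a general odd level `k`. [this node] -/
theorem not_dichotomy_of_odd_diagonal {m N k : ℕ} (hk : Odd k) (hN : 2 ≤ N) (hNm : N ≤ m)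
    (hm : (k - 1) * (m - 1) < k * (N - 1)) (hne : k ∉ emptyLevels N N) : k ∉ passLevels m N ∪ emptyLevels m N :=
  fun h => hne ((dichotomy_iff_empty_of_odd_diagonal hk hN hNm hm).mp h)

/-- **Point levels of the unit tensor in column 2:** for `m ≥ 2`, `k ∈ pointLevels 2 ⟨m⟩ ↔ k` even. [this node] -/
theorem mem_pointLevels_two_unitTensor_iff {m k : ℕ} (hm : 2 ≤ m) : k ∈ pointLevels 2 (unitTensor ℂ m) ↔ Even k := by
  constructor
  · rintro ⟨F, hF, hne⟩
    rcases Nat.even_or_odd k with he | ho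
    · exact he
    · exfalso
      have hbot : hwvSpace (rectType m 2 k) (k * 2) = ⊥ := (mem_emptyLevels_two_iff hm).mpr ho
      rw [hbot, Submodule.mem_bot] at hF
      exact hne (by rw [hF, map_zero])
  · rintro ⟨j, rfl⟩
    rw [← two_mul, mul_comm]
    exact mul_mem_pointLevels (two_mem_pointLevels_unitTensor hm) j

end SaturationWindow

end Summit.MatrixMultiplication.MatrixMultiplication.Theorems.ObstructionCalculus

end
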